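import Summits.PneNP.PneNP.Theses.SzkEntropy
import Summits.PneNP.PneNP.Theorems.PeaWorstToAvg.Negative.PeaWorstToAvgStrengthenings
import Literature.Computability.Complexity.PolynomialEntropyApproximation
import Literature.Computability.MetaComplexity.SamplableMixtures

/-!
# PneNP / SzkEntropy — crux `PeaWorstToAvg` (stmt-PneNP-10777), negative side: non-vacuity of the ∃D's
# side conditions (a two-sided samplable on-promise ensemble exists)

Route `PneNP/SzkEntropy`, crux item stmt-PneNP-10777 (`PeaWorstToAvg`).  Standing-disprover content
(`Cruxes/PeaWorstToAvg/Disproof.lean`, §4(iii)).  By `PeaWorstToAvgStrengthenings.lean` a witness `D` of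
the crux's conclusion must be polynomial-time samplable, supported on the promise, AND two-sided (charge
yes- and no-instances).  This file checks that these side conditions are jointly satisfiable, so the
interface the ∃D ranges over is not vacuous for a trivial reason:

* `encode_peaIdInst_mem_yes` — the identity map on `F₂¹` with threshold `0` is a YES instance of every
  `PEA d`, `d ≥ 1` (`H = log₂ 2 = 1 ≥ 0 + 1`, entropy of an injective map);
* `pea_exists_twoSided_samplable_onPromise` — the fair mixture of the point masses on that yes-instance and
  on the empty no-instance (`encode_peaEmptyInst_mem_no`) is samplable (`isPolySamplable_mixEnsemble`,
  `isPolySamplable_const`), on the promise, and two-sided at every index.  (It is of course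
  `HeurBPP`-easy — compare the input with a constant — so it is no witness; hardness is the whole content.)

References: Z. Dvir, D. Gutfreund, G. N. Rothblum, S. Vadhan, *On approximating the entropy of
polynomial mappings*, ICS 2011, §3 p. 6 and Claim 2.2; A. Bogdanov, L. Trevisan, *Average-Case
Complexity* (2006), Def. 2.1.
-/

namespace Summit.PneNP.PneNP.Theorems

open Literature.Computability.Complexity Literature.Computability.MetaComplexity
open Summit.PneNP.PneNP.Theses.SzkEntropy
open _root_.Computability

/-- **The identity map on `F₂¹` with threshold `k = 0` is a YES instance of every `PEA d`, `d ≥ 1`**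
(`H = 1 ≥ 0 + 1`: the map `x ↦ [x₀]` is injective on `F₂¹`, so its output entropy is `log₂ |F₂¹| = 1`,
`mapEntropy_of_injective`). [DvirGutfreundRothblumVadhan2010, §3 p. 6 and Claim 2.2] -/
theorem encode_peaIdInst_mem_yes {d : ℕ} (hd : 1 ≤ d) :
    PEAInst.encoding.encode (⟨1, ([[[0]]], 0)⟩ : PEAInst) ∈ (PEA d).yes := by
  refine (encode_mem_PEA_yes_iff d _).2 ⟨?_, ?_⟩
  · intro p hp μ hμ
    simp only [List.mem_singleton] at hp
    subst hp
    simp only [List.mem_singleton] at hμ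
    subst hμ
    simpa using hd
  · show ((0 : ℕ) : ℝ) + 1 ≤ PolyMapF2.entropy ([[[0]]] : PolyMapF2 1)
    have hinj : Function.Injective (PolyMapF2.eval ([[[0]]] : PolyMapF2 1)) := by
      intro x y hxy
      have h0 : x 0 = y 0 := by simpa [PolyMapF2.eval] using hxy
      funext i
      have hi : i = 0 := Subsingleton.elim i 0
      rw [hi, h0]
    rw [PolyMapF2.entropy, mapEntropy_of_injective _ hinj, Finset.card_univ, Fintype.card_fun,
      ZMod.card, Fintype.card_fin]
    norm_num

/-- **A two-sided, polynomial-time samplable, on-promise ensemble of `PEA₃` instances exists**: the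
fair mixture of the point masses on the identity yes-instance and the empty no-instance.  So the side
conditions of the crux's ∃D (samplable, on the promise) together with the necessary two-sidedness
(`pea_exists_yes_and_no_of_not_mem_HeurBPP`) are jointly satisfiable; what remains is hardness alone.
[BogdanovTrevisan2006, Def. 2.1; DvirGutfreundRothblumVadhan2010, §3 p. 6] -/
theorem pea_exists_twoSided_samplable_onPromise :
    ∃ D : Ensemble, D.IsPolySamplable ∧
      (∀ n : ℕ, ∀ w ∈ (D n).support, w ∈ (PEA 3).yes ∨ w ∈ (PEA 3).no) ∧
      (∀ n, ∃ w ∈ (D n).support, w ∈ (PEA 3).yes) ∧ (∀ n, ∃ w ∈ (D n).support, w ∈ (PEA 3).no) := by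
  set yW := PEAInst.encoding.encode (⟨1, ([[[0]]], 0)⟩ : PEAInst) with hyW
  set nW := PEAInst.encoding.encode (⟨0, ([], 0)⟩ : PEAInst) with hnW
  have hy : yW ∈ (PEA 3).yes := encode_peaIdInst_mem_yes (by norm_num)
  have hn : nW ∈ (PEA 3).no := encode_peaEmptyInst_mem_no 3
  refine ⟨mixEnsemble (fun _ => PMF.pure yW) (fun _ => PMF.pure nW),
    Ensemble.isPolySamplable_mixEnsemble (isPolySamplable_const yW) (isPolySamplable_const nW),
    fun n w hw => ?_, fun n => ⟨yW, ?_, hy⟩, fun n => ⟨nW, ?_, hn⟩⟩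
  · rw [mem_support_mixEnsemble_iff] at hw
    rcases hw with hw | hw
    · left
      have : w = yW := by simpa using hw
      rw [this]
      exact hy
    · right
      have : w = nW := by simpa using hw
      rw [this]
      exact hn
  · rw [mem_support_mixEnsemble_iff]
    left
    simp
  · rw [mem_support_mixEnsemble_iff]
    right
    simp

end Summit.PneNP.PneNP.Theorems
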